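import Literature.ModelTheory.ExponentialFields.CylindricalDecompositionProofs
import Literature.NumberTheory.Transcendental.KZSemiCanonicalReductionProofs
import Literature.NumberTheory.Transcendental.KZLogCalculusProofs
import Literature.NumberTheory.Transcendental.KZProductIdeal
import Mathlib.Analysis.Analytic.Constructions
import Mathlib.Analysis.Analytic.Linear

/-!
# `SectorToKernel` (stmt-KontsevichZagierPeriods-10813), line `effective-cube-surjection`, stub F:
# assembly — bounded volumes from straightenable cells

Helper file for the lead's stub `stub_nashCellReductionOf` (skeleton v6).  Given the dichotomy
"open or empty interior" for cells (stub D (1)) and the existence of adapted cylindrical decompositions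
with straightenable open bounded cells (`nash_cad`), a bounded `ℚ`-semialgebraic volume `[K, 1]` is
congruent modulo the Kontsevich–Zagier relations to a `ℤ`-combination of open-cube Nash classes of the
same dimension: cut `[K, 1]` along the cells of a decomposition adapted to `K` (iterated rule (1a),
`KZ.of_sub_sum_of_mem_relations`); cells with empty interior are null
(`KZ.volume_eq_zero_of_interior_eq_empty`); an open cell is straightened at level `q = 0` after the
relabelling `Fin m ≃ Fin (0 + m)` (`KZ.of_sub_of_reindex_mem_relations`).
[Kontsevich–Zagier 2001, §1.2 rules (1), (2); Bochnak–Coste–Roy 1998, Prop. 2.9.10]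
-/

noncomputable section

namespace Summit.KontsevichZagierPeriods.FurushoPentagon.SectorToKernel

open Set MeasureTheory Filter Topology
open Literature.ModelTheory.ExponentialFields
open Literature.NumberTheory.Transcendental
open Literature.NumberTheory.Transcendental.KZ

/-- Transport of the open-cube Nash span along `Fin a ≃ Fin b` (copy of `span_transport` of the
straightening file, kept here to make this file independent of it). [cite: KontsevichZagier2001, §1.2 rule (2)] -/
theorem span_transport' {a b : ℕ} (e : Fin a ≃ Fin b) :
    ∀ c ∈ AddSubgroup.closure {d : FormalRep | ∃ v : IntegralRep a,
        v.domain = {x : Fin a → ℝ | ∀ i, 0 < x i ∧ x i < 1} ∧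
        AnalyticOnNhd ℝ v.integrand {x : Fin a → ℝ | ∀ i, 0 < x i ∧ x i < 1} ∧ d = of v},
      ∃ c' ∈ AddSubgroup.closure {d : FormalRep | ∃ v : IntegralRep b,
        v.domain = {x : Fin b → ℝ | ∀ i, 0 < x i ∧ x i < 1} ∧
        AnalyticOnNhd ℝ v.integrand {x : Fin b → ℝ | ∀ i, 0 < x i ∧ x i < 1} ∧ d = of v},
      c - c' ∈ relations := by
  intro c hc
  induction hc using AddSubgroup.closure_induction with
  | mem x hx =>
    obtain ⟨v, hvd, hva, rfl⟩ := hx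
    have hdom : (v.reindex e).domain = {x : Fin b → ℝ | ∀ i, 0 < x i ∧ x i < 1} := by
      ext w
      simp only [IntegralRep.reindex_domain, hvd, mem_setOf_eq]
      exact ⟨fun h i => by simpa using h (e.symm i), fun h i => h (e i)⟩
    have han : AnalyticOnNhd ℝ (v.reindex e).integrand {x : Fin b → ℝ | ∀ i, 0 < x i ∧ x i < 1} := by
      intro w hw
      rw [IntegralRep.reindex_integrand]
      set L : (Fin b → ℝ) →L[ℝ] (Fin a → ℝ) := ContinuousLinearMap.pi fun i => ContinuousLinearMap.proj (e i)
      have hmem : (fun i => w (e i)) ∈ {x : Fin a → ℝ | ∀ i, 0 < x i ∧ x i < 1} := fun i => hw (e i)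
      exact (hva _ hmem).comp (L.analyticAt w)
    exact ⟨of (v.reindex e), AddSubgroup.subset_closure ⟨v.reindex e, hdom, han, rfl⟩,
      of_sub_of_reindex_mem_relations v e⟩
  | zero => exact ⟨0, AddSubgroup.zero_mem _, by simp⟩
  | add x y _ _ hx hy =>
    obtain ⟨a', ha', hxa⟩ := hx
    obtain ⟨b', hb', hyb⟩ := hy
    refine ⟨a' + b', AddSubgroup.add_mem _ ha' hb', ?_⟩
    have : x + y - (a' + b') = (x - a') + (y - b') := by abel
    rw [this]
    exact relations.add_mem hxa hyb
  | neg x _ hx =>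
    obtain ⟨a', ha', hxa⟩ := hx
    refine ⟨-a', AddSubgroup.neg_mem _ ha', ?_⟩
    have : -x - -a' = -(x - a') := by abel
    rw [this]
    exact relations.neg_mem hxa

/-- **Bounded volumes from straightenable cells.**  If every cell of a `ℚ`-cylindrical decomposition is
open or has empty interior, and every finite family of `ℚ`-semialgebraic sets has an adapted cylindrical
decomposition whose open bounded cells are straightenable, then every bounded volume `[K, 1]` is congruent
modulo relations to a `ℤ`-combination of open-cube Nash classes of the same dimension.
[cite: KontsevichZagier2001, §1.2 rules (1),(2)] [cite: BochnakCosteRoy1998, Prop. 2.9.10] -/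
theorem nashCellReduction_of_nashCad
    (hD1 : ∀ (n : ℕ) (𝒮 : Finset (Set (Fin n → ℝ))), IsCylindricalDecomposition ℚ n 𝒮 →
        ∀ S ∈ 𝒮, IsOpen S ∨ interior S = ∅)
    (hMain : ∀ (n : ℕ) (F : Finset (Set (Fin n → ℝ))), (∀ s ∈ F, IsSemialgebraic ℚ s) →
      ∃ 𝒮 : Finset (Set (Fin n → ℝ)), IsCylindricalDecomposition ℚ n 𝒮 ∧
        (∀ s ∈ F, ∃ 𝒞 ⊆ 𝒮, ⋃₀ (𝒞 : Set (Set (Fin n → ℝ))) = s) ∧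
        ∀ S ∈ 𝒮, IsOpen S → Bornology.IsBounded S → ∀ (q : ℕ) (r : IntegralRep (q + n)),
          r.domain = {z | (∀ i : Fin q, 0 < z (Fin.castAdd n i) ∧ z (Fin.castAdd n i) < 1) ∧
            (fun j => z (Fin.natAdd q j)) ∈ S} →
          AnalyticOnNhd ℝ r.integrand r.domain →
          ∃ c ∈ AddSubgroup.closure {d : FormalRep | ∃ v : IntegralRep (q + n),
              v.domain = {x : Fin (q + n) → ℝ | ∀ i, 0 < x i ∧ x i < 1} ∧
              AnalyticOnNhd ℝ v.integrand {x : Fin (q + n) → ℝ | ∀ i, 0 < x i ∧ x i < 1} ∧ d = of v},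
            of r - c ∈ relations) :
    ∀ (m : ℕ) (K : IntegralRep m), Bornology.IsBounded K.domain → (∀ x ∈ K.domain, K.integrand x = 1) →
      ∃ c ∈ AddSubgroup.closure {d : FormalRep | ∃ v : IntegralRep m,
        v.domain = {x : Fin m → ℝ | ∀ i, 0 < x i ∧ x i < 1} ∧
        AnalyticOnNhd ℝ v.integrand {x : Fin m → ℝ | ∀ i, 0 < x i ∧ x i < 1} ∧ d = of v},
        of K - c ∈ relations := by
  classical
  intro m K hKb hK1
  obtain ⟨𝒮, hcd, hadapt, hstr⟩ := hMain m {K.domain} (by simpa using K.isSemialgebraic_domain)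
  have hpart := hcd.isPartition
  have hsa := hcd.isSemialgebraic
  obtain ⟨𝒞, h𝒞, hU⟩ := hadapt K.domain (Finset.mem_singleton_self _)
  have hCsub : ∀ C ∈ 𝒞, C ⊆ K.domain := fun C hC => hU ▸ subset_sUnion_of_mem hC
  -- the pieces of `K` over the cells of `𝒞`
  let R : {C // C ∈ 𝒞} → IntegralRep m := fun C =>
    K.restrict C.1 (hsa C.1 (h𝒞 C.2)) (hCsub C.1 C.2)
  have eR : of K - ∑ C ∈ 𝒞.attach, of (R C) ∈ relations := by
    refine of_sub_sum_of_mem_relations 𝒞.attach K R (fun C _ => ?_) (fun C _ x _ => rfl) ?_ ?_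
    · rw [show (R C).domain \ K.domain = ∅ from Set.sdiff_eq_empty.2 (hCsub C.1 C.2), measure_empty]
    · have : K.domain \ ⋃ C ∈ 𝒞.attach, (R C).domain = ∅ := by
        refine Set.sdiff_eq_empty.2 fun x hx => ?_
        rw [← hU] at hx
        obtain ⟨C, hC, hxC⟩ := mem_sUnion.1 hx
        exact mem_iUnion₂.2 ⟨⟨C, hC⟩, Finset.mem_attach _ _, hxC⟩
      rw [this, measure_empty]
    · intro C _ C' _ hne
      have hne' : (C : Set (Fin m → ℝ)) ≠ C' := fun h => hne (Subtype.ext h)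
      have : (R C).domain ∩ (R C').domain = ∅ := by
        refine eq_empty_of_forall_notMem fun x hx => hne' ?_
        obtain ⟨T, -, huniq⟩ := hpart.2 x
        exact (huniq C.1 ⟨by exact_mod_cast h𝒞 C.2, hx.1⟩).trans
          (huniq C'.1 ⟨by exact_mod_cast h𝒞 C'.2, hx.2⟩).symm
      rw [this, measure_empty]
  -- each piece is an open-cube Nash combination modulo relations
  have hcell : ∀ C : {C // C ∈ 𝒞}, ∃ c ∈ AddSubgroup.closure {d : FormalRep | ∃ v : IntegralRep m,
      v.domain = {x : Fin m → ℝ | ∀ i, 0 < x i ∧ x i < 1} ∧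
      AnalyticOnNhd ℝ v.integrand {x : Fin m → ℝ | ∀ i, 0 < x i ∧ x i < 1} ∧ d = of v},
      of (R C) - c ∈ relations := by
    intro C
    by_cases hint : interior (C : Set (Fin m → ℝ)) = ∅
    · refine ⟨0, AddSubgroup.zero_mem _, ?_⟩
      rw [sub_zero]
      exact of_mem_relations_of_volume_eq_zero (R C)
        (volume_eq_zero_of_interior_eq_empty (hsa C.1 (h𝒞 C.2)) hint)
    have hCo : IsOpen (C : Set (Fin m → ℝ)) := (hD1 m 𝒮 hcd C.1 (h𝒞 C.2)).resolve_right hint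
    have hCb : Bornology.IsBounded (C : Set (Fin m → ℝ)) := hKb.subset (hCsub C.1 C.2)
    -- relabel `Fin m ≃ Fin (0 + m)` and straighten at level `q = 0`
    let e₀ : Fin m ≃ Fin (0 + m) := ⟨Fin.natAdd 0, fun j => ⟨j.1, by omega⟩,
      fun i => Fin.ext (by simp), fun j => Fin.ext (by simp)⟩
    have he₀ : ∀ i, e₀ i = Fin.natAdd 0 i := fun i => rfl
    set r₀ : IntegralRep (0 + m) := (R C).reindex e₀ with hr₀
    have hr₀d : r₀.domain = {z | (∀ i : Fin 0, 0 < z (Fin.castAdd m i) ∧ z (Fin.castAdd m i) < 1) ∧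
        (fun j => z (Fin.natAdd 0 j)) ∈ (C : Set (Fin m → ℝ))} := by
      rw [hr₀, IntegralRep.reindex_domain]
      ext w
      simp only [IntegralRep.domain_restrict, mem_setOf_eq, IsEmpty.forall_iff, true_and, R, he₀]
    have hr₀a : AnalyticOnNhd ℝ r₀.integrand r₀.domain := by
      intro w hw
      rw [hr₀, IntegralRep.reindex_domain] at hw
      have hwC : (fun i => w (e₀ i)) ∈ (C : Set (Fin m → ℝ)) := hw
      rw [hr₀, IntegralRep.reindex_integrand]
      have hL : Continuous fun w : Fin (0 + m) → ℝ => fun i => w (e₀ i) :=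
        continuous_pi fun i => continuous_apply _
      have hnhds : {w : Fin (0 + m) → ℝ | (fun i => w (e₀ i)) ∈ (C : Set (Fin m → ℝ))} ∈ 𝓝 w :=
        (hCo.preimage hL).mem_nhds hwC
      refine (analyticAt_const (v := (1 : ℝ))).congr ?_
      filter_upwards [hnhds] with w' hw'
      exact (hK1 _ (hCsub C.1 C.2 hw')).symm
    obtain ⟨c, hc, hr₀c⟩ := hstr C.1 (h𝒞 C.2) hCo hCb 0 r₀ hr₀d hr₀a
    obtain ⟨c', hc', hcc'⟩ := span_transport' e₀.symm c hc
    refine ⟨c', hc', ?_⟩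
    have : of (R C) - c' = (of (R C) - of r₀) + (of r₀ - c) + (c - c') := by abel
    rw [this]
    exact relations.add_mem (relations.add_mem (of_sub_of_reindex_mem_relations (R C) e₀) hr₀c) hcc'
  choose cc hcc hRcc using hcell
  refine ⟨∑ C ∈ 𝒞.attach, cc C, AddSubgroup.sum_mem _ fun C _ => hcc C, ?_⟩
  have : of K - ∑ C ∈ 𝒞.attach, cc C = (of K - ∑ C ∈ 𝒞.attach, of (R C)) +
      (∑ C ∈ 𝒞.attach, of (R C) - ∑ C ∈ 𝒞.attach, cc C) := by abel
  rw [this]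
  exact relations.add_mem eR (sum_sub_sum_mem_relations _ _ _ fun C _ => hRcc C)


/-- **Bounded volumes from straightenable cells** (registered form: all hypotheses after the colon).
See `nashCellReduction_of_nashCad`. [cite: KontsevichZagier2001, §1.2 rules (1),(2)] -/
theorem nashCellReduction_of_cad :
    (∀ (n : ℕ) (𝒮 : Finset (Set (Fin n → ℝ))), IsCylindricalDecomposition ℚ n 𝒮 →
        ∀ S ∈ 𝒮, IsOpen S ∨ interior S = ∅) →
    (∀ (n : ℕ) (F : Finset (Set (Fin n → ℝ))), (∀ s ∈ F, IsSemialgebraic ℚ s) →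
      ∃ 𝒮 : Finset (Set (Fin n → ℝ)), IsCylindricalDecomposition ℚ n 𝒮 ∧
        (∀ s ∈ F, ∃ 𝒞 ⊆ 𝒮, ⋃₀ (𝒞 : Set (Set (Fin n → ℝ))) = s) ∧
        ∀ S ∈ 𝒮, IsOpen S → Bornology.IsBounded S → ∀ (q : ℕ) (r : IntegralRep (q + n)),
          r.domain = {z | (∀ i : Fin q, 0 < z (Fin.castAdd n i) ∧ z (Fin.castAdd n i) < 1) ∧
            (fun j => z (Fin.natAdd q j)) ∈ S} →
          AnalyticOnNhd ℝ r.integrand r.domain →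
          ∃ c ∈ AddSubgroup.closure {d : FormalRep | ∃ v : IntegralRep (q + n),
              v.domain = {x : Fin (q + n) → ℝ | ∀ i, 0 < x i ∧ x i < 1} ∧
              AnalyticOnNhd ℝ v.integrand {x : Fin (q + n) → ℝ | ∀ i, 0 < x i ∧ x i < 1} ∧ d = of v},
            of r - c ∈ relations) →
    ∀ (m : ℕ) (K : IntegralRep m), Bornology.IsBounded K.domain → (∀ x ∈ K.domain, K.integrand x = 1) →
      ∃ c ∈ AddSubgroup.closure {d : FormalRep | ∃ v : IntegralRep m,
        v.domain = {x : Fin m → ℝ | ∀ i, 0 < x i ∧ x i < 1} ∧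
        AnalyticOnNhd ℝ v.integrand {x : Fin m → ℝ | ∀ i, 0 < x i ∧ x i < 1} ∧ d = of v},
        of K - c ∈ relations :=
  fun hD1 hMain => nashCellReduction_of_nashCad hD1 hMain

end Summit.KontsevichZagierPeriods.FurushoPentagon.SectorToKernel
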